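import Summits.KontsevichZagierPeriods.Zeta5Search.LaiSweepShard

/-!
# `κ₃` sweep certificate — shard file 117 of 127 (shards 819–825 of 889)

HONEST FRAMING. Systematic search; no irrationality claim unless certified. This file only checks,
by `decide +kernel`, shards 819–825 of the order-cell sweep of the `κ₃` point `(74, 2180, 444; δ74)`
(engine `LaiSweepEngine`, soundness `LaiSweepJump/Free/Eval/Shard/Kappa3`; a shard is `⟨regime, n,
p, q, p', q', Lo, Up⟩`: `n` cells from `p/q` to `p'/q'` with integer rate sums in `[Lo, Up]`, `K =
128`, `D = 2^40`). It draws NO conclusion: only the capstone `LaiKappa3SweepCert`, which needs all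
127 shard files, does. Kernel cost of this file ≈ 560 cells × 0.3 s.
-/

namespace Summit.KontsevichZagierPeriods.Zeta5Search.Sweep

set_option maxHeartbeats 100000000 in
/-- Shard 819: 80 cells of regime B from `198/217` to `233/255`.
[cite: Lai2024BallRivoal, §4 Lemma 4.3] -/
theorem shard819 :
    Shard.check 128 (2^40)
      ⟨true, 80, 198, 217, 233, 255, 10602305032018, 18104426987905⟩ = true := by
  decide +kernel

set_option maxHeartbeats 100000000 in
/-- Shard 820: 80 cells of regime B from `233/255` to `226/247`.
[cite: Lai2024BallRivoal, §4 Lemma 4.3] -/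
theorem shard820 :
    Shard.check 128 (2^40)
      ⟨true, 80, 233, 255, 226, 247, 10354590307247, 17699834102747⟩ = true := by
  decide +kernel

set_option maxHeartbeats 100000000 in
/-- Shard 821: 80 cells of regime B from `226/247` to `339/370`.
[cite: Lai2024BallRivoal, §4 Lemma 4.3] -/
theorem shard821 :
    Shard.check 128 (2^40)
      ⟨true, 80, 226, 247, 339, 370, 10202239888648, 17457230000314⟩ = true := by
  decide +kernel

set_option maxHeartbeats 100000000 in
/-- Shard 822: 80 cells of regime B from `339/370` to `345/376`.
[cite: Lai2024BallRivoal, §4 Lemma 4.3] -/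
theorem shard822 :
    Shard.check 128 (2^40)
      ⟨true, 80, 339, 370, 345, 376, 11014936630979, 18867942141286⟩ = true := by
  decide +kernel

set_option maxHeartbeats 100000000 in
/-- Shard 823: 80 cells of regime B from `345/376` to `396/431`.
[cite: Lai2024BallRivoal, §4 Lemma 4.3] -/
theorem shard823 :
    Shard.check 128 (2^40)
      ⟨true, 80, 345, 376, 396, 431, 10218964685817, 17522855683918⟩ = true := by
  decide +kernel

set_option maxHeartbeats 100000000 in
/-- Shard 824: 80 cells of regime B from `396/431` to `380/413`.
[cite: Lai2024BallRivoal, §4 Lemma 4.3] -/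
theorem shard824 :
    Shard.check 128 (2^40)
      ⟨true, 80, 396, 431, 380, 413, 10728448171981, 18415758700090⟩ = true := by
  decide +kernel

set_option maxHeartbeats 100000000 in
/-- Shard 825: 80 cells of regime B from `380/413` to `199/216`.
[cite: Lai2024BallRivoal, §4 Lemma 4.3] -/
theorem shard825 :
    Shard.check 128 (2^40)
      ⟨true, 80, 380, 413, 199, 216, 9869316726736, 16958373895566⟩ = true := by
  decide +kernel

/-- The checked shards of this file, in order. [folklore] -/
def shards117 : List (CheckedShard 128 (2^40)) :=
  [⟨_, shard819⟩, ⟨_, shard820⟩, ⟨_, shard821⟩, ⟨_, shard822⟩, ⟨_, shard823⟩,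
    ⟨_, shard824⟩, ⟨_, shard825⟩]

end Summit.KontsevichZagierPeriods.Zeta5Search.Sweep
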